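import Mathlib
import Summits.QuantumAdvantage.QuantumAdvantage.Theorems.LinnikCubicClassGroupsPureCubicClassNumberHardThreeRamifiedUnits
import HarnessLib

/-!
# Chevalley's ambiguous ideals with THREE ramified primes, II: a non-principal invariant ideal (Hasse-free)

Continuation of `…ThreeRamifiedUnits.lean` (route `LinnikCubicClassGroups`, crux
`PureCubicClassNumberHard`, stmt-QuantumAdvantage-11826; Honda 1971).

* `exists_nonprincipal_cell` — for `L/F` cyclic cubic with generator `σ`, `F` totally complex with
  units `uⁱ v³`, and three pairwise distinct primes `P₁, P₂, P₃` of `L` totally ramified over `F`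
  (`e = 3`, `Pᵢ³ = (tᵢ)`, `tᵢ ∈ 𝓞_F`): **some `P₁^a P₂^b P₃^d` (`a, b, d < 3`) is not principal**.
  Otherwise the 27 generators `y_c` give 27 norm-one units `ε_c = σ(y_c)/y_c`; as
  `#Ĥ⁻¹(σ, 𝓞_Lˣ) ≤ 9`, two are equivalent, `ε_c η = ε_{c'} σ(η)`; then `y_c/(y_{c'} η)` is
  `σ`-fixed, i.e. in `F`, so `y_c f₂ = f₁ y_{c'} η` with `fᵢ ∈ 𝓞_F`, and comparing `Pᵢ`-adic
  valuations (cubes on `𝓞_F`) gives `c ≡ c' (mod 3)`, a contradiction.  No norm theorem is used.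

HONEST FRAMING (block-2b rule): kernel-checked classical algebraic number theory, NOT summit
progress; the crux `PureCubicClassNumberHard` is hypothesis-type.

## References
* T. Honda, *Pure cubic fields whose class numbers are multiples of three*, J. Number Theory 3
  (1971) 7–12. [Honda1971]
* C. Chevalley, *Sur la théorie du corps de classes dans les corps finis et les corps locaux*,
  J. Fac. Sci. Tokyo 2 (1933) (ambiguous ideal classes). [folklore]
-/

set_option linter.dupNamespace false

noncomputable section

open NumberField

open scoped Pointwise NumberField IntermediateField

namespace Summit.QuantumAdvantage.QuantumAdvantage.Theorems.LinnikCubicClassGroups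

open Literature.NumberTheory.GaloisRepresentations
open Literature.NumberTheory.GaloisRepresentations.MinkowskiUnit
open Literature.NumberTheory.NumberFields IsDedekindDomain

/-! ### Three ramified primes: not every cell is principal -/

/-- **Three ramified primes force a non-principal invariant ideal.**  Let `L/F` be cyclic cubic with
generator `σ`, `F` totally complex with units `uⁱ v³`, `𝓞_F` a PID, and `P₁, P₂, P₃` pairwise
distinct maximal ideals of `𝓞_L`, totally ramified over `F` (`e = 3`, `Pᵢ³ = (tᵢ)`, `tᵢ ∈ 𝓞_F`)
and carrying all the ramification.  Then some `P₁^a P₂^b P₃^d` (`a, b, d < 3`) is NOT principal: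
otherwise the `27` generators `y_c` give `27` norm-one units `ε_c = σ(y_c)/y_c`, two of which are
equivalent (`#Ĥ⁻¹(σ, 𝓞_Lˣ) ≤ 9`), say `ε_c η = ε_{c'} σ(η)`; then `y_c/(y_{c'} η)` is `σ`-fixed,
hence in `F`, so `(f₂)(y_c) = (f₁)(y_{c'})` with `fᵢ ∈ 𝓞_F`, whose `Pᵢ`-adic valuations — cubes
for elements of `F` — give `c ≡ c' (mod 3)`, a contradiction. [folklore] -/
theorem exists_nonprincipal_cell
    (F L : Type) [Field F] [NumberField F] [Field L] [NumberField L] [Algebra F L]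
    [IsGalois F L] (σ : L ≃ₐ[F] L) (hσ : ∀ τ : L ≃ₐ[F] L, τ ∈ Subgroup.zpowers σ)
    (hdeg : Module.finrank F L = 3) (hcx : ∀ v : NumberField.InfinitePlace F, v.IsComplex)
    (u : (𝓞 F)ˣ) (hgen : ∀ w : (𝓞 F)ˣ, ∃ i : ℕ, ∃ v : (𝓞 F)ˣ, w = u ^ i * v ^ 3)
    {P₁ P₂ P₃ : Ideal (𝓞 L)} (hP₁ : P₁.IsMaximal) (hP₂ : P₂.IsMaximal) (hP₃ : P₃.IsMaximal)
    (h12 : P₁ ≠ P₂) (h13 : P₁ ≠ P₃) (h23 : P₂ ≠ P₃)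
    (he₁ : P₁.ramificationIdx (𝓞 F) = 3) (he₂ : P₂.ramificationIdx (𝓞 F) = 3)
    (he₃ : P₃.ramificationIdx (𝓞 F) = 3)
    {t₁ : 𝓞 F} (ht₁ : Ideal.span {algebraMap (𝓞 F) (𝓞 L) t₁} = P₁ ^ 3)
    {t₂ : 𝓞 F} (ht₂ : Ideal.span {algebraMap (𝓞 F) (𝓞 L) t₂} = P₂ ^ 3)
    {t₃ : 𝓞 F} (ht₃ : Ideal.span {algebraMap (𝓞 F) (𝓞 L) t₃} = P₃ ^ 3) :
    ∃ a b d : ℕ, a < 3 ∧ b < 3 ∧ d < 3 ∧ ¬ Submodule.IsPrincipal (P₁ ^ a * P₂ ^ b * P₃ ^ d) := by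
  classical
  by_contra hall
  push Not at hall
  -- generators of the 27 cells
  let ι := Fin 3 × Fin 3 × Fin 3
  let I : ι → Ideal (𝓞 L) := fun c => P₁ ^ (c.1 : ℕ) * P₂ ^ (c.2.1 : ℕ) * P₃ ^ (c.2.2 : ℕ)
  have hIpr : ∀ c, Submodule.IsPrincipal (I c) := fun c => hall _ _ _ c.1.isLt c.2.1.isLt c.2.2.isLt
  have hy : ∀ c, ∃ y : 𝓞 L, I c = Ideal.span {y} := fun c => by
    obtain ⟨y, hy⟩ := (hIpr c).principal
    exact ⟨y, by rw [hy, Ideal.submodule_span_eq]⟩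
  choose y hy using hy
  haveI := hP₁
  haveI := hP₂
  haveI := hP₃
  have hP₁0 : P₁ ≠ ⊥ := Ideal.IsMaximal.ne_bot_of_isIntegral_int P₁
  have hP₂0 : P₂ ≠ ⊥ := Ideal.IsMaximal.ne_bot_of_isIntegral_int P₂
  have hP₃0 : P₃ ≠ ⊥ := Ideal.IsMaximal.ne_bot_of_isIntegral_int P₃
  have hI0 : ∀ c, I c ≠ ⊥ := fun c =>
    mul_ne_zero (mul_ne_zero (pow_ne_zero _ hP₁0) (pow_ne_zero _ hP₂0)) (pow_ne_zero _ hP₃0)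
  have hy0 : ∀ c, y c ≠ 0 := fun c h => hI0 c (by rw [hy c, h, Ideal.span_singleton_eq_bot])
  -- the cells are `σ`-invariant
  have hinv : ∀ c, σ • I c = I c := by
    intro c
    simp only [I, smul_mul', smul_pow', smul_eq_of_pow_three_eq_span σ hP₁ ht₁,
      smul_eq_of_pow_three_eq_span σ hP₂ ht₂, smul_eq_of_pow_three_eq_span σ hP₃ ht₃]
  -- hence `σ y_c = y_c ε_c` with a norm-one unit `ε_c`
  have hε : ∀ c, ∃ ε : (𝓞 L)ˣ, σ • y c = y c * ε := by
    intro c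
    have h := hinv c
    rw [hy c, pointwise_smul_span_singleton, Ideal.span_singleton_eq_span_singleton] at h
    obtain ⟨e, he⟩ := h
    refine ⟨e⁻¹, ?_⟩
    nth_rw 2 [← he]
    rw [mul_assoc, Units.mul_inv, mul_one]
  choose ε hε using hε
  haveI : FiniteDimensional F L := Module.Finite.of_restrictScalars_finite ℚ F L
  have hεN : ∀ c, Algebra.norm F (((ε c : 𝓞 L) : L)) = 1 := by
    intro c
    have h := congrArg (fun z : 𝓞 L => Algebra.norm F ((z : L))) (hε c)
    simp only [RingOfIntegers.coe_eq_algebraMap, map_mul] at h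
    have hσy : algebraMap (𝓞 L) L (σ • y c) = σ (algebraMap (𝓞 L) L (y c)) := rfl
    rw [hσy, norm_smul_eq] at h
    have hN0 : Algebra.norm F (algebraMap (𝓞 L) L (y c)) ≠ 0 :=
      Algebra.norm_ne_zero_iff.mpr (RingOfIntegers.coe_ne_zero_iff.mpr (hy0 c))
    have := mul_left_cancel₀ hN0 (h.symm.trans (mul_one _).symm)
    rw [RingOfIntegers.coe_eq_algebraMap]
    exact this
  -- two equivalent units among the 27
  have hcardι : 9 < Fintype.card ι := by simp [ι]
  obtain ⟨c, c', hcc', η, hη⟩ :=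
    exists_equiv_of_ten_normOne_units F L σ hσ hdeg hcx u hgen hcardι ε hεN
  -- `x = y_c / (y_{c'} η)` is `σ`-fixed
  set Y : 𝓞 L →+* L := algebraMap (𝓞 L) L with hYdef
  have hσY : ∀ z : 𝓞 L, σ (Y z) = Y (σ • z) := fun z => rfl
  have hYε : ∀ c, σ (Y (y c)) = Y (y c) * Y (ε c) := by
    intro c; rw [hσY, hε c, map_mul]
  have hYy0 : ∀ c, Y (y c) ≠ 0 := fun c => RingOfIntegers.coe_ne_zero_iff.mpr (hy0 c)
  have hYη0 : Y (η : 𝓞 L) ≠ 0 := RingOfIntegers.coe_ne_zero_iff.mpr (Units.ne_zero _)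
  have hYεc0 : Y (ε c) ≠ 0 := RingOfIntegers.coe_ne_zero_iff.mpr (Units.ne_zero _)
  set x : L := Y (y c) / (Y (y c') * Y (η : 𝓞 L)) with hxdef
  have hησ : Y (ε c) * Y (η : 𝓞 L) = Y (ε c') * σ (Y (η : 𝓞 L)) := by
    simpa [hYdef, RingOfIntegers.coe_eq_algebraMap] using hη
  have hσx : σ x = x := by
    rw [hxdef, map_div₀, map_mul, hYε c, hYε c', mul_assoc (Y (y c')), ← hησ,
      mul_comm (Y (ε c)) (Y (η : 𝓞 L)), ← mul_assoc, mul_div_mul_right _ _ hYεc0]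
  -- hence `x ∈ F`
  have hfix : ∀ τ : L ≃ₐ[F] L, τ x = x := by
    intro τ
    have hτ : τ ∈ MulAction.stabilizer (L ≃ₐ[F] L) x :=
      (Subgroup.zpowers_le.mpr (MulAction.mem_stabilizer_iff.mpr hσx)) (hσ τ)
    exact MulAction.mem_stabilizer_iff.mp hτ
  obtain ⟨f, hf⟩ := (IsGalois.mem_range_algebraMap_iff_fixed x).mpr hfix
  obtain ⟨f₁, f₂, hf₂, hf12⟩ := IsFractionRing.div_surjective (A := 𝓞 F) f
  have hf₂0 : f₂ ≠ 0 := nonZeroDivisors.ne_zero hf₂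
  have hf₂F : algebraMap (𝓞 F) F f₂ ≠ 0 := fun h =>
    hf₂0 ((IsFractionRing.injective (𝓞 F) F) (by rw [h, map_zero]))
  -- clear denominators: `y_c · f₂ = f₁ · y_{c'} · η` in `L`
  have hx0 : x ≠ 0 := div_ne_zero (hYy0 c) (mul_ne_zero (hYy0 c') hYη0)
  have hf₁0 : f₁ ≠ 0 := by
    rintro rfl
    apply hx0
    rw [← hf, ← hf12]; simp
  have hrel : y c * algebraMap (𝓞 F) (𝓞 L) f₂ =
      algebraMap (𝓞 F) (𝓞 L) f₁ * y c' * (η : 𝓞 L) := by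
    apply RingOfIntegers.coe_injective
    have h1 : Y (y c) = x * (Y (y c') * Y (η : 𝓞 L)) := by
      rw [hxdef, div_mul_cancel₀ _ (mul_ne_zero (hYy0 c') hYη0)]
    have h2 : x * algebraMap F L (algebraMap (𝓞 F) F f₂) = algebraMap F L (algebraMap (𝓞 F) F f₁) := by
      rw [← hf, ← hf12, ← map_mul, div_mul_cancel₀ _ hf₂F]
    have hF : ∀ g : 𝓞 F, ((algebraMap (𝓞 F) (𝓞 L) g : 𝓞 L) : L) =
        algebraMap F L (algebraMap (𝓞 F) F g) := fun g => by
      rw [RingOfIntegers.coe_eq_algebraMap, ← IsScalarTower.algebraMap_apply,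
        ← IsScalarTower.algebraMap_apply]
    simp only [map_mul] at h1 ⊢
    rw [← RingOfIntegers.coe_eq_algebraMap (algebraMap (𝓞 F) (𝓞 L) f₂),
      ← RingOfIntegers.coe_eq_algebraMap (algebraMap (𝓞 F) (𝓞 L) f₁), hF, hF]
    change Y (y c) * algebraMap F L (algebraMap (𝓞 F) F f₂) =
      algebraMap F L (algebraMap (𝓞 F) F f₁) * Y (y c') * Y (η : 𝓞 L)
    rw [h1, mul_assoc x, mul_comm (Y (y c') * Y (η : 𝓞 L)), ← mul_assoc, h2]
    ring
  -- compare valuations at `P₁`, `P₂`, `P₃`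
  have key : ∀ (P : Ideal (𝓞 L)) (hP : P.IsMaximal) (heP : P.ramificationIdx (𝓞 F) = 3)
      (n n' : ℕ) (J J' : Ideal (𝓞 L)),
      Ideal.span {y c} = P ^ n * J → ¬ P ∣ J → Ideal.span {y c'} = P ^ n' * J' → ¬ P ∣ J' →
      (n : ℤ) ≡ n' [ZMOD 3] := by
    intro P hP heP n n' J J' hJ hPJ hJ' hPJ'
    let w : HeightOneSpectrum (𝓞 L) := ⟨P, hP.isPrime, Ideal.IsMaximal.ne_bot_of_isIntegral_int P⟩
    have hvc : w.intValuation (y c) = WithZero.exp (-(n : ℤ)) :=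
      intValuation_eq_exp_of_span_eq w (hy0 c) hJ hPJ
    have hvc' : w.intValuation (y c') = WithZero.exp (-(n' : ℤ)) :=
      intValuation_eq_exp_of_span_eq w (hy0 c') hJ' hPJ'
    obtain ⟨k₁, hk₁⟩ := intValuation_algebraMap_eq_exp_three_mul w heP hf₁0
    obtain ⟨k₂, hk₂⟩ := intValuation_algebraMap_eq_exp_three_mul w heP hf₂0
    have hvη : w.intValuation (η : 𝓞 L) = 1 :=
      HeightOneSpectrum.intValuation_eq_one_iff.mpr fun h =>
        hP.ne_top (Ideal.eq_top_of_isUnit_mem _ h (Units.isUnit η))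
    have h := congrArg w.intValuation hrel
    rw [map_mul, map_mul, map_mul, hvc, hk₂, hk₁, hvc', hvη, mul_one, ← WithZero.exp_add,
      ← WithZero.exp_add, WithZero.exp_inj] at h
    exact Int.modEq_iff_dvd.mpr ⟨(k₂ : ℤ) - k₁, by linarith⟩
  -- primality bookkeeping
  have hprime₁ := Ideal.prime_of_isPrime (Ideal.IsMaximal.ne_bot_of_isIntegral_int P₁) hP₁.isPrime
  have hprime₂ := Ideal.prime_of_isPrime (Ideal.IsMaximal.ne_bot_of_isIntegral_int P₂) hP₂.isPrime
  have hprime₃ := Ideal.prime_of_isPrime (Ideal.IsMaximal.ne_bot_of_isIntegral_int P₃) hP₃.isPrime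
  have hndvd : ∀ {P Q : Ideal (𝓞 L)}, P.IsMaximal → Q.IsMaximal → P ≠ Q → ∀ n : ℕ, ¬ P ∣ Q ^ n := by
    intro P Q hP hQ hPQ n h
    have h' := (Ideal.prime_of_isPrime (Ideal.IsMaximal.ne_bot_of_isIntegral_int P) hP.isPrime).dvd_of_dvd_pow h
    exact hPQ ((hQ.eq_of_le hP.ne_top (Ideal.le_of_dvd h')).symm)
  have hndvd_mul : ∀ {P A B : Ideal (𝓞 L)}, P.IsMaximal → ¬ P ∣ A → ¬ P ∣ B → ¬ P ∣ A * B := by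
    intro P A B hP hA hB h
    rcases (Ideal.prime_of_isPrime (Ideal.IsMaximal.ne_bot_of_isIntegral_int P) hP.isPrime).dvd_or_dvd h with h | h
    exacts [hA h, hB h]
  -- the three congruences
  have e1 : ((c.1 : ℕ) : ℤ) ≡ (c'.1 : ℕ) [ZMOD 3] := by
    refine key P₁ hP₁ he₁ _ _ (P₂ ^ (c.2.1 : ℕ) * P₃ ^ (c.2.2 : ℕ)) (P₂ ^ (c'.2.1 : ℕ) * P₃ ^ (c'.2.2 : ℕ))
      ?_ ?_ ?_ ?_
    · rw [← hy c]; simp only [I]; ring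
    · exact hndvd_mul hP₁ (hndvd hP₁ hP₂ h12 _) (hndvd hP₁ hP₃ h13 _)
    · rw [← hy c']; simp only [I]; ring
    · exact hndvd_mul hP₁ (hndvd hP₁ hP₂ h12 _) (hndvd hP₁ hP₃ h13 _)
  have e2 : ((c.2.1 : ℕ) : ℤ) ≡ (c'.2.1 : ℕ) [ZMOD 3] := by
    refine key P₂ hP₂ he₂ _ _ (P₁ ^ (c.1 : ℕ) * P₃ ^ (c.2.2 : ℕ)) (P₁ ^ (c'.1 : ℕ) * P₃ ^ (c'.2.2 : ℕ))
      ?_ ?_ ?_ ?_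
    · rw [← hy c]; simp only [I]; ring
    · exact hndvd_mul hP₂ (hndvd hP₂ hP₁ h12.symm _) (hndvd hP₂ hP₃ h23 _)
    · rw [← hy c']; simp only [I]; ring
    · exact hndvd_mul hP₂ (hndvd hP₂ hP₁ h12.symm _) (hndvd hP₂ hP₃ h23 _)
  have e3 : ((c.2.2 : ℕ) : ℤ) ≡ (c'.2.2 : ℕ) [ZMOD 3] := by
    refine key P₃ hP₃ he₃ _ _ (P₁ ^ (c.1 : ℕ) * P₂ ^ (c.2.1 : ℕ)) (P₁ ^ (c'.1 : ℕ) * P₂ ^ (c'.2.1 : ℕ))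
      ?_ ?_ ?_ ?_
    · rw [← hy c]; simp only [I]; ring
    · exact hndvd_mul hP₃ (hndvd hP₃ hP₁ h13.symm _) (hndvd hP₃ hP₂ h23.symm _)
    · rw [← hy c']; simp only [I]; ring
    · exact hndvd_mul hP₃ (hndvd hP₃ hP₁ h13.symm _) (hndvd hP₃ hP₂ h23.symm _)
  apply hcc'
  have f1 : c.1 = c'.1 := by
    apply Fin.ext; have h := e1; rw [Int.ModEq] at h; have := c.1.isLt; have := c'.1.isLt; omega
  have f2 : c.2.1 = c'.2.1 := by
    apply Fin.ext; have h := e2; rw [Int.ModEq] at h; have := c.2.1.isLt; have := c'.2.1.isLt; omega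
  have f3 : c.2.2 = c'.2.2 := by
    apply Fin.ext; have h := e3; rw [Int.ModEq] at h; have := c.2.2.isLt; have := c'.2.2.isLt; omega
  exact Prod.ext f1 (Prod.ext f2 f3)

end Summit.QuantumAdvantage.QuantumAdvantage.Theorems.LinnikCubicClassGroups

end
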